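import Literature.Analysis.Complex.EarleHamiltonBallFixedPoint
import Literature.Analysis.Complex.WeierstrassBanach
import Literature.Analysis.Complex.HolomorphicParametricIntegral
import Literature.Analysis.Complex.HolomorphicBanach

/-!
# `Balaban1983to89.B15Prop1ParametricZeroBranch` — [Balaban1989LargeFieldII] p. 359: *«Using Proposition 4 [15] and the fixed point theorem for
# contractive mappings, we can easily prove that the above equation has exactly one solution … The above equations, bounds and statements are
# valid for 𝔤ᶜ-valued fields, hence the existence of the analytic extension follows immediately»* — THE PARAMETRIC FORM: the zero of a
# holomorphic FAMILY of maps with uniformly invertible linearisation is an ANALYTIC function of the parameter (quantitative, on explicit balls)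

statement-level skeleton of published theorems with citation tags; proofs where landed; nothing here is a claim about
the Yang–Mills mass gap

Cell pub-ymgap, HUMAN RULING D-0062 (Track A full width), seat `pub-ymgap-dag-n12-c` (R134 acceleration seat (a), strategy s1 of DAG node N12 = [B15];
generation g5, third product).  PDF held: `paper:balaban1989-cmp122-large-field-ii` (p. 359 = PDF 5).

WHY (the INTRINSIC READING of the analytic-extension clause of [Balaban1989LargeFieldI] Prop. 1 p. 194).  r13's complex model
(`B16Prop1IVAnalytic`, `B16Prop1IVFromProp4.prop1IV_complex`) proves the last sentence of the p. 359 proof for FIXED operators `H_{1,k}`, `Δ₁(ζ₀)`,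
`(δ/δA)V`, the datum entering linearly through the current `J` (its HONEST SCOPE: *«the dependence of the operators … on the background U_{k,Z}(V_k)
(also analytic in print) is not modelled»*).  In the intrinsic reading of (1.11)–(1.12) (`B15Prop1IntrinsicReading`, p513628) the criticality
equation at the perturbed datum `exp(ip)V_k` is `∇_{B′} g(p, B′) = 0` for ONE jointly analytic function `g(p, B′) = A(U_{k,Z}(exp(iB′)·ext(exp(ip)V_k)))`,
so ALL Taylor data move with the parameter `p`.  This file supplies the corresponding generic statement: for a family `𝒦(p̃, B̃)` of maps
`Ec → Ec` (think `𝒦 = ∇_{B̃} g`), jointly complex-differentiable and bounded on a ball of `Pc × Ec`, whose linearisation `L = ∂_{B̃}𝒦(0, 0)` has a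
bounded inverse, and with `𝒦(0,0)` small, the equation `𝒦(p̃, B̃) = 0` has for every small `p̃` exactly one small solution `B̃ = Φ(p̃)`, and `Φ`
is complex-analytic — print's *«fixed point theorem for contractive mappings»* made parametric, with the analyticity *«following immediately»*.

THE MECHANISM (everything BY NAME from the tree's `Literature/Analysis/Complex`).  `T_{p̃}(B̃) = B̃ − L⁻¹𝒦(p̃, B̃)` is complex-differentiable in
`B̃` and maps the ball `‖B̃‖ < r′` into the closed ball of radius `r′/2` (the second-order Schwarz estimate
`Literature.Analysis.Complex.norm_sub_sub_fderiv_le_of_forall_mem_ball_norm_le` on `Pc × Ec` and Cauchy's estimate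
`…norm_fderiv_le_of_forall_mem_ball_norm_le` control `L B̃ − 𝒦(p̃, B̃)` by `‖𝒦(0,0)‖ + (2𝓑/ρ₀)‖p̃‖ + 4𝓑‖(p̃,B̃)‖²/ρ₀²`); the EARLE–HAMILTON
fixed-point theorem (`Literature.Analysis.Complex.EarleHamilton.exists_fixedPoint_tendsto_iterate`, `fixedPoint_unique`, `norm_iterate_sub_iterate_le`,
[Chae1985] Thm 13.18) gives the unique fixed point `Φ(p̃)` and GEOMETRIC convergence of the iterates `T_{p̃}ⁿ(0)` UNIFORMLY in `p̃`; each iterate is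
complex-differentiable in `p̃` (chain rule through the joint map), so `Φ` is complex-differentiable by the Banach-space Weierstrass theorem in its
«closed subspace» form (`Literature.Analysis.Complex.WeierstrassBanach.differentiableOn_of_forall_exists_near`, [Mujica1986] Prop. 9.13) and analytic
([Chae1985] Thm 14.13, `Literature.Analysis.Complex.HolomorphicBanach.analyticOnNhd_of_differentiableOn`).

WHAT THIS FILE PROVES (Mathlib + the four Analysis imports; theorems only; no `sorry`, no definition, no `… : Prop` fact; axioms standard).
§1 `hasFDerivAt_section` ∕ `differentiableOn_section` ∕ `norm_prodMk_lt` — partial-derivative bookkeeping on `Pc × Ec` (sup norm).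
§2 `norm_self_sub_kinv_apply_le` — the self-map estimate `‖B̃ − L⁻¹𝒦(p̃,B̃)‖ ≤ c⁻¹(‖𝒦(0,0)‖ + (2𝓑/ρ₀)‖p̃‖ + 4𝓑·max(‖p̃‖,‖B̃‖)²/ρ₀²)`.
§3 ★★ **`exists_analytic_zero_branch`** — the theorem described above, with explicit smallness conditions `r′ ≤ ρ₀/2`, `r′ ≤ cρ₀²/(24𝓑)`, `ε ≤ r′`,
   `ε ≤ c·r′·ρ₀/(12𝓑)`, `‖𝒦(0,0)‖ ≤ c·r′/6`: there is `Φ : Pc → Ec`, ANALYTIC on `‖p̃‖ < ε`, with `‖Φ(p̃)‖ ≤ r′/2`, `𝒦(p̃, Φ(p̃)) = 0`, and every zero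
   `B̃` of `𝒦(p̃, ·)` with `‖B̃‖ < r′` equals `Φ(p̃)`.

HONEST SCOPE.  Generic complex analysis in the service of one sentence of [Balaban1989LargeFieldII]; no object of Bałaban's is constructed and nothing
of NODE 00 is declared.  The sequel `B15Prop1IntrinsicAnalyticExt` applies it to `𝒦 = ` the complex slice gradient of the joint holomorphic extension of
print's function.  Count-neutral; NOT a discharge of N12; NOT summit progress; nothing continuum ∕ OS ∕ mass-gap ∕ Clay.
-/

noncomputable section

open Set Metric Filter
open scoped Topology

namespace Literature.MathematicalPhysics.QuantumFieldTheory.Balaban1983to89.B15Prop1ParametricZeroBranch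

open Literature.Analysis.Complex (norm_fderiv_le_of_forall_mem_ball_norm_le norm_sub_sub_fderiv_le_of_forall_mem_ball_norm_le)
open Literature.Analysis.Complex.EarleHamilton (exists_fixedPoint_tendsto_iterate fixedPoint_unique norm_iterate_sub_iterate_le)
open Literature.Analysis.Complex.WeierstrassBanach (differentiableOn_of_forall_exists_near)

variable {Pc : Type*} [NormedAddCommGroup Pc] [NormedSpace ℂ Pc]
variable {Ec : Type*} [NormedAddCommGroup Ec] [NormedSpace ℂ Ec]

/-! ## §1 Partial derivatives on `Pc × Ec` -/

omit [NormedSpace ℂ Pc] [NormedSpace ℂ Ec] in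
/-- The sup norm of a pair is below `ρ` iff both components are (bookkeeping). [cite: Balaban1989LargeFieldII, p.359] -/
theorem norm_prodMk_lt {p : Pc} {B : Ec} {ρ : ℝ} (hp : ‖p‖ < ρ) (hB : ‖B‖ < ρ) : ‖(p, B)‖ < ρ := by
  rw [Prod.norm_def]; exact max_lt hp hB

/-- **THE `B̃`-SECTION OF A JOINTLY DIFFERENTIABLE MAP**: if `𝒦` is complex-differentiable at `(p̃, B̃)`, then `B̃′ ↦ 𝒦(p̃, B̃′)` has at `B̃` the Fréchet
derivative `D𝒦(p̃,B̃) ∘ inr` (chain rule with `B̃′ ↦ (p̃, B̃′)`). [cite: Balaban1989LargeFieldII, p.359 («valid for 𝔤ᶜ-valued fields»)] -/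
theorem hasFDerivAt_section {G : Type*} [NormedAddCommGroup G] [NormedSpace ℂ G] (𝒦 : Pc × Ec → G) {z : Pc × Ec}
    (h : DifferentiableAt ℂ 𝒦 z) :
    HasFDerivAt (fun B' : Ec => 𝒦 (z.1, B')) ((fderiv ℂ 𝒦 z).comp (ContinuousLinearMap.inr ℂ Pc Ec)) z.2 := by
  obtain ⟨p, B⟩ := z
  exact h.hasFDerivAt.comp B (hasFDerivAt_prodMk_right p B)

/-- The `B̃`-section of a map complex-differentiable on the ball `‖(p̃,B̃)‖ < ρ₀` is complex-differentiable on `‖B̃‖ < ρ₀` for each `‖p̃‖ < ρ₀`.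
[cite: Balaban1989LargeFieldII, p.359 («valid for 𝔤ᶜ-valued fields»)] -/
theorem differentiableOn_section {G : Type*} [NormedAddCommGroup G] [NormedSpace ℂ G] (𝒦 : Pc × Ec → G) {ρ₀ : ℝ}
    (h𝒦 : DifferentiableOn ℂ 𝒦 (ball 0 ρ₀)) {p : Pc} (hp : ‖p‖ < ρ₀) :
    DifferentiableOn ℂ (fun B' : Ec => 𝒦 (p, B')) (ball 0 ρ₀) := by
  refine h𝒦.comp ((differentiableOn_const p).prodMk differentiableOn_id) fun B hB => ?_
  rw [mem_ball_zero_iff] at hB ⊢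
  exact norm_prodMk_lt hp hB

/-! ## §2 The self-map estimate -/

/-- **THE SELF-MAP ESTIMATE** for `T_{p̃}(B̃) = B̃ − L⁻¹𝒦(p̃,B̃)`, `L = D𝒦(0) ∘ inr`: if `𝒦` is complex-differentiable on `‖z‖ < ρ₀` (`z = (p̃,B̃)`, sup
norm) and bounded by `𝓑` there, `L⁻¹ ∘ L = id` and `‖L⁻¹x‖ ≤ c⁻¹‖x‖`, then for `‖p̃‖, ‖B̃‖ < ρ₀`:
`‖B̃ − L⁻¹𝒦(p̃,B̃)‖ ≤ c⁻¹(‖𝒦(0,0)‖ + (2𝓑/ρ₀)‖p̃‖ + 4𝓑(‖(p̃,B̃)‖/ρ₀)²)` — since `B̃ − L⁻¹𝒦(z) = −L⁻¹(𝒦(0) + D𝒦(0)(p̃,0) + [𝒦(z) − 𝒦(0) − D𝒦(0)z])`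
(Cauchy's estimate for `D𝒦(0)`, the second-order Schwarz estimate for the bracket). [cite: Balaban1989LargeFieldII, (1.13) p.359 («the fixed
point theorem for contractive mappings … twice a bound of the right-hand side»)] -/
theorem norm_self_sub_kinv_apply_le (𝒦 : Pc × Ec → Ec) {ρ₀ 𝓑 c : ℝ} (hρ₀ : 0 < ρ₀) (h𝒦 : DifferentiableOn ℂ 𝒦 (ball 0 ρ₀))
    (h𝓑 : ∀ z ∈ ball (0 : Pc × Ec) ρ₀, ‖𝒦 z‖ ≤ 𝓑) (Kinv : Ec →L[ℂ] Ec)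
    (hKL : ∀ x : Ec, Kinv (((fderiv ℂ 𝒦 0).comp (ContinuousLinearMap.inr ℂ Pc Ec)) x) = x) (hc : 0 < c)
    (hKn : ∀ x : Ec, ‖Kinv x‖ ≤ c⁻¹ * ‖x‖) {p : Pc} {B : Ec} (hp : ‖p‖ < ρ₀) (hB : ‖B‖ < ρ₀) :
    ‖B - Kinv (𝒦 (p, B))‖ ≤ c⁻¹ * (‖𝒦 0‖ + 2 * 𝓑 / ρ₀ * ‖p‖ + 4 * 𝓑 * (‖(p, B)‖ / ρ₀) ^ 2) := by
  have hz : (p, B) ∈ ball (0 : Pc × Ec) ρ₀ := by rw [mem_ball_zero_iff]; exact norm_prodMk_lt hp hB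
  -- the decomposition `B − Kinv (𝒦 z) = −Kinv (𝒦 0 + D𝒦(0)(p,0) + R)`
  set D : Pc × Ec →L[ℂ] Ec := fderiv ℂ 𝒦 0 with hD
  set R : Ec := 𝒦 (p, B) - 𝒦 0 - D ((p, B) - 0) with hR
  have hsplit : (p, B) = ((p, (0 : Ec)) : Pc × Ec) + ContinuousLinearMap.inr ℂ Pc Ec B := by simp
  have hDz : D ((p, B) - 0) = D (p, (0 : Ec)) + D (ContinuousLinearMap.inr ℂ Pc Ec B) := by
    rw [sub_zero]
    conv_lhs => rw [hsplit]
    rw [map_add]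
  have hLB : Kinv (D (ContinuousLinearMap.inr ℂ Pc Ec B)) = B := hKL B
  have hkey : B - Kinv (𝒦 (p, B)) = -Kinv (𝒦 0 + D (p, (0 : Ec)) + R) := by
    have e1 : 𝒦 (p, B) = 𝒦 0 + D (p, (0 : Ec)) + D (ContinuousLinearMap.inr ℂ Pc Ec B) + R := by
      rw [hR, hDz]; abel
    rw [e1, map_add, map_add, map_add, hLB, map_add, map_add]
    abel
  -- the three bounds
  have h0 : ‖𝒦 0‖ ≤ 𝓑 := h𝓑 0 (mem_ball_self hρ₀)
  have hDn : ‖D‖ ≤ 2 * 𝓑 / ρ₀ := norm_fderiv_le_of_forall_mem_ball_norm_le hρ₀ h𝒦 h𝓑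
  have hp0 : ‖((p, (0 : Ec)) : Pc × Ec)‖ = ‖p‖ := by simp [Prod.norm_def]
  have h1 : ‖D (p, (0 : Ec))‖ ≤ 2 * 𝓑 / ρ₀ * ‖p‖ := by
    calc ‖D (p, (0 : Ec))‖ ≤ ‖D‖ * ‖((p, (0 : Ec)) : Pc × Ec)‖ := D.le_opNorm _
      _ ≤ 2 * 𝓑 / ρ₀ * ‖p‖ := by rw [hp0]; exact mul_le_mul_of_nonneg_right hDn (norm_nonneg _)
  have h2 : ‖R‖ ≤ 4 * 𝓑 * (‖(p, B)‖ / ρ₀) ^ 2 := by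
    have h := norm_sub_sub_fderiv_le_of_forall_mem_ball_norm_le h𝒦 h𝓑 hz
    rw [sub_zero] at h
    rw [hR, sub_zero]
    exact h
  calc ‖B - Kinv (𝒦 (p, B))‖ = ‖Kinv (𝒦 0 + D (p, (0 : Ec)) + R)‖ := by rw [hkey, norm_neg]
    _ ≤ c⁻¹ * ‖𝒦 0 + D (p, (0 : Ec)) + R‖ := hKn _
    _ ≤ c⁻¹ * (‖𝒦 0‖ + ‖D (p, (0 : Ec))‖ + ‖R‖) := by
        refine mul_le_mul_of_nonneg_left ?_ (inv_nonneg.2 hc.le)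
        linarith [norm_add_le (𝒦 0 + D (p, (0 : Ec))) R, norm_add_le (𝒦 0) (D (p, (0 : Ec)))]
    _ ≤ c⁻¹ * (‖𝒦 0‖ + 2 * 𝓑 / ρ₀ * ‖p‖ + 4 * 𝓑 * (‖(p, B)‖ / ρ₀) ^ 2) := by
        refine mul_le_mul_of_nonneg_left ?_ (inv_nonneg.2 hc.le)
        linarith

/-- The arithmetic of the self-map: under the smallness conditions of §3 the estimate of `norm_self_sub_kinv_apply_le` is `≤ r′/2` on
`‖p̃‖ < ε`, `‖B̃‖ < r′` (bookkeeping). [cite: Balaban1989LargeFieldII, (1.13) p.359] -/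
private theorem selfMap_arith {ρ₀ 𝓑 c r' ε j np nB : ℝ} (hρ₀ : 0 < ρ₀) (h𝓑 : 0 < 𝓑) (hc : 0 < c)
    (hr' : 0 < r') (hr'c : r' ≤ c * ρ₀ ^ 2 / (24 * 𝓑)) (hεr : ε ≤ r') (hεc : ε ≤ c * r' * ρ₀ / (12 * 𝓑))
    (hj : j ≤ c * r' / 6) (hnp : np < ε) (hnp0 : 0 ≤ np) (hnB : nB < r') :
    c⁻¹ * (j + 2 * 𝓑 / ρ₀ * np + 4 * 𝓑 * (max np nB / ρ₀) ^ 2) ≤ r' / 2 := by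
  have hmax : max np nB ≤ r' := max_le (hnp.le.trans hεr) hnB.le
  have hmax0 : 0 ≤ max np nB := le_max_of_le_left hnp0
  -- term 2: `2𝓑/ρ₀ · np ≤ c r'/6`
  have t2 : 2 * 𝓑 / ρ₀ * np ≤ c * r' / 6 := by
    have h1 : 2 * 𝓑 / ρ₀ * np ≤ 2 * 𝓑 / ρ₀ * (c * r' * ρ₀ / (12 * 𝓑)) :=
      mul_le_mul_of_nonneg_left (hnp.le.trans hεc) (by positivity)
    have e : 2 * 𝓑 / ρ₀ * (c * r' * ρ₀ / (12 * 𝓑)) = c * r' / 6 := by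
      field_simp
      norm_num
    linarith [h1, e.le]
  -- term 3: `4𝓑 (max/ρ₀)² ≤ 4𝓑 r'²/ρ₀² ≤ c r'/6`
  have t3 : 4 * 𝓑 * (max np nB / ρ₀) ^ 2 ≤ c * r' / 6 := by
    have h1 : (max np nB / ρ₀) ^ 2 ≤ (r' / ρ₀) ^ 2 :=
      pow_le_pow_left₀ (div_nonneg hmax0 hρ₀.le) (div_le_div_of_nonneg_right hmax hρ₀.le) 2
    have h2 : 4 * 𝓑 * (r' / ρ₀) ^ 2 = (4 * 𝓑 * r' / ρ₀ ^ 2) * r' := by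
      field_simp
    have h3 : 4 * 𝓑 * r' / ρ₀ ^ 2 ≤ c / 6 := by
      rw [div_le_iff₀ (by positivity)]
      have := (le_div_iff₀ (by positivity : (0 : ℝ) < 24 * 𝓑)).1 hr'c
      nlinarith
    calc 4 * 𝓑 * (max np nB / ρ₀) ^ 2 ≤ 4 * 𝓑 * (r' / ρ₀) ^ 2 := mul_le_mul_of_nonneg_left h1 (by positivity)
      _ = (4 * 𝓑 * r' / ρ₀ ^ 2) * r' := h2
      _ ≤ (c / 6) * r' := mul_le_mul_of_nonneg_right h3 hr'.le
      _ = c * r' / 6 := by ring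
  have hsum : j + 2 * 𝓑 / ρ₀ * np + 4 * 𝓑 * (max np nB / ρ₀) ^ 2 ≤ c * r' / 2 := by linarith
  calc c⁻¹ * (j + 2 * 𝓑 / ρ₀ * np + 4 * 𝓑 * (max np nB / ρ₀) ^ 2) ≤ c⁻¹ * (c * r' / 2) :=
        mul_le_mul_of_nonneg_left hsum (inv_nonneg.2 hc.le)
    _ = r' / 2 := by field_simp

/-! ## §3 The analytic zero branch -/

variable [CompleteSpace Ec]

/-- ★★ **THE ANALYTIC ZERO BRANCH OF A HOLOMORPHIC FAMILY** (print's *«fixed point theorem for contractive mappings … valid for 𝔤ᶜ-valued fields,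
hence the existence of the analytic extension follows immediately»*, made parametric).  Let `𝒦 : Pc × Ec → Ec` be complex-differentiable on the ball
`‖(p̃,B̃)‖ < ρ₀` (sup norm), bounded by `𝓑 > 0` there; let `L = D𝒦(0) ∘ inr` (the linearisation in `B̃` at the origin) have a two-sided bounded inverse
`L⁻¹` with `‖L⁻¹x‖ ≤ c⁻¹‖x‖`; and let the radii satisfy `ε ≤ r′ ≤ ρ₀/2`, `0 < r′`, `r′ ≤ cρ₀²/(24𝓑)`, `ε ≤ c·r′·ρ₀/(12𝓑)`, `‖𝒦(0,0)‖ ≤ c·r′/6`.  THEN there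
is `Φ : Pc → Ec`, complex-ANALYTIC on `‖p̃‖ < ε`, such that for every `‖p̃‖ < ε`: `‖Φ(p̃)‖ ≤ r′/2`, `𝒦(p̃, Φ(p̃)) = 0`, and every `B̃` with `‖B̃‖ < r′` and
`𝒦(p̃, B̃) = 0` equals `Φ(p̃)`.  Proof: `T_{p̃}(B̃) = B̃ − L⁻¹𝒦(p̃,B̃)` maps `ball 0 r′` into `closedBall 0 (r′/2)` (§2) and is complex-differentiable;
Earle–Hamilton gives the unique fixed point and uniform geometric convergence of `T_{p̃}ⁿ(0)`, each complex-differentiable in `p̃`; the Banach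
Weierstrass theorem («closed subspace» form) and [Chae1985] Thm 14.13 give analyticity. [cite: Balaban1989LargeFieldII, (1.12)–(1.13) p.359;
Balaban1989LargeFieldI, Prop. 1 p.194 («has an analytic extension for Gᶜ-valued configurations»)] -/
theorem exists_analytic_zero_branch (𝒦 : Pc × Ec → Ec) {ρ₀ 𝓑 c r' ε : ℝ} (hρ₀ : 0 < ρ₀)
    (h𝒦 : DifferentiableOn ℂ 𝒦 (ball 0 ρ₀)) (h𝓑 : ∀ z ∈ ball (0 : Pc × Ec) ρ₀, ‖𝒦 z‖ ≤ 𝓑) (h𝓑0 : 0 < 𝓑)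
    (Kinv : Ec →L[ℂ] Ec) (hKL : ∀ x : Ec, Kinv (((fderiv ℂ 𝒦 0).comp (ContinuousLinearMap.inr ℂ Pc Ec)) x) = x)
    (hLK : ∀ x : Ec, ((fderiv ℂ 𝒦 0).comp (ContinuousLinearMap.inr ℂ Pc Ec)) (Kinv x) = x)
    (hc : 0 < c) (hKn : ∀ x : Ec, ‖Kinv x‖ ≤ c⁻¹ * ‖x‖)
    (hr' : 0 < r') (hr'ρ : r' ≤ ρ₀ / 2) (hr'c : r' ≤ c * ρ₀ ^ 2 / (24 * 𝓑)) (hεr : ε ≤ r')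
    (hεc : ε ≤ c * r' * ρ₀ / (12 * 𝓑)) (hj : ‖𝒦 0‖ ≤ c * r' / 6) :
    ∃ Φ : Pc → Ec, AnalyticOnNhd ℂ Φ (ball 0 ε) ∧
      ∀ p ∈ ball (0 : Pc) ε, ‖Φ p‖ ≤ r' / 2 ∧ 𝒦 (p, Φ p) = 0 ∧
        ∀ B ∈ ball (0 : Ec) r', 𝒦 (p, B) = 0 → B = Φ p := by
  -- the maps `T_p`
  set T : Pc → Ec → Ec := fun p B => B - Kinv (𝒦 (p, B)) with hT
  have hr'ρ₀ : r' < ρ₀ := by linarith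
  have hερ₀ : ε < ρ₀ := by linarith
  -- holomorphy of `T_p` in `B` and the self-map property, for `‖p‖ < ε`
  have hTd : ∀ p : Pc, ‖p‖ < ε → DifferentiableOn ℂ (T p) (ball 0 r') := by
    intro p hp
    have h1 : DifferentiableOn ℂ (fun B : Ec => 𝒦 (p, B)) (ball 0 r') :=
      (differentiableOn_section 𝒦 h𝒦 (hp.trans hερ₀)).mono (ball_subset_ball hr'ρ₀.le)
    exact differentiableOn_id.sub (Kinv.differentiable.comp_differentiableOn h1)
  have hTmaps : ∀ p : Pc, ‖p‖ < ε → MapsTo (T p) (ball (0 : Ec) r') (closedBall (0 : Ec) (1 / 2 * r')) := by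
    intro p hp B hB
    rw [mem_ball_zero_iff] at hB
    rw [mem_closedBall_zero_iff]
    have h := norm_self_sub_kinv_apply_le 𝒦 hρ₀ h𝒦 h𝓑 Kinv hKL hc hKn (hp.trans hερ₀) (hB.trans hr'ρ₀)
    have harith := selfMap_arith hρ₀ h𝓑0 hc hr' hr'c hεr hεc hj hp (norm_nonneg p) hB
    rw [Prod.norm_def] at h
    calc ‖T p B‖ = ‖B - Kinv (𝒦 (p, B))‖ := rfl
      _ ≤ _ := h
      _ ≤ r' / 2 := harith
      _ = 1 / 2 * r' := by ring
  -- Earle–Hamilton: the fixed point, for each `‖p‖ < ε`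
  have hθ0 : (0 : ℝ) < 1 / 2 := by norm_num
  have hθ1 : (1 / 2 : ℝ) < 1 := by norm_num
  have h0mem : (0 : Ec) ∈ closedBall (0 : Ec) (1 / 2 * r') := mem_closedBall_self (by positivity)
  have hfix : ∀ p : Pc, ‖p‖ < ε → ∃ x ∈ closedBall (0 : Ec) (1 / 2 * r'), T p x = x := by
    intro p hp
    obtain ⟨x, hx, hTx, -⟩ := exists_fixedPoint_tendsto_iterate hr' hθ0 hθ1 (hTd p hp) (hTmaps p hp) h0mem
    exact ⟨x, hx, hTx⟩
  choose! Φ hΦmem hΦfix using hfix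
  -- zeros of `𝒦 (p, ·)` ↔ fixed points of `T p`
  have hzero_iff : ∀ (p : Pc) (B : Ec), 𝒦 (p, B) = 0 ↔ T p B = B := by
    intro p B
    constructor
    · intro h; simp only [hT, h, map_zero, sub_zero]
    · intro h
      have h1 : Kinv (𝒦 (p, B)) = 0 := by
        have : B - Kinv (𝒦 (p, B)) = B := h
        simpa using this
      have h2 := congrArg (fun x => ((fderiv ℂ 𝒦 0).comp (ContinuousLinearMap.inr ℂ Pc Ec)) x) h1
      simp only [hLK, map_zero] at h2
      exact h2
  -- the iterates are complex-differentiable in `p` and stay in the half ball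
  have hiter : ∀ n : ℕ, DifferentiableOn ℂ (fun p : Pc => (T p)^[n] 0) (ball 0 ε) ∧
      ∀ p : Pc, ‖p‖ < ε → ‖(T p)^[n] 0‖ ≤ r' / 2 := by
    intro n
    induction n with
    | zero =>
      refine ⟨?_, fun p _ => ?_⟩
      · simp only [Function.iterate_zero, id_eq]; exact differentiableOn_const _
      · simp only [Function.iterate_zero, id_eq, norm_zero]; positivity
    | succ n ih =>
      obtain ⟨ihd, ihb⟩ := ih
      have hsucc : (fun p : Pc => (T p)^[n + 1] 0) = fun p => T p ((T p)^[n] 0) := by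
        funext p; rw [Function.iterate_succ_apply']
      refine ⟨?_, fun p hp => ?_⟩
      · rw [hsucc]
        have hmaps : MapsTo (fun p : Pc => (p, (T p)^[n] 0)) (ball (0 : Pc) ε) (ball (0 : Pc × Ec) ρ₀) := by
          intro p hp
          rw [mem_ball_zero_iff] at hp ⊢
          exact norm_prodMk_lt (hp.trans hερ₀) ((ihb p hp).trans_lt (by linarith))
        have h1 : DifferentiableOn ℂ (fun p : Pc => 𝒦 (p, (T p)^[n] 0)) (ball 0 ε) :=
          h𝒦.comp (differentiableOn_id.prodMk ihd) hmaps
        exact ihd.sub (Kinv.differentiable.comp_differentiableOn h1)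
      · rw [Function.iterate_succ_apply']
        have hmem : (T p)^[n] 0 ∈ ball (0 : Ec) r' := by
          rw [mem_ball_zero_iff]; exact (ihb p hp).trans_lt (by linarith)
        have h := hTmaps p hp hmem
        rw [mem_closedBall_zero_iff] at h
        linarith
  -- uniform geometric approximation of `Φ` by the iterates
  have happrox : ∀ (n : ℕ) (p : Pc), ‖p‖ < ε → ‖Φ p - (T p)^[n] 0‖ ≤ 4 * (2 / 3) ^ n * (r' / 2) := by
    intro n p hp
    have key := norm_iterate_sub_iterate_le hr' hθ0 hθ1 (hTd p hp) (hTmaps p hp) n (hΦmem p hp) h0mem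
    rw [Function.iterate_fixed (hΦfix p hp) n, sub_zero] at key
    have hΦn : ‖Φ p‖ ≤ r' / 2 := by
      have h := hΦmem p hp
      rw [mem_closedBall_zero_iff] at h
      linarith
    have e1 : (2 : ℝ) / (1 - 1 / 2) = 4 := by norm_num
    have e2 : (2 : ℝ) * (1 / 2) / (1 + 1 / 2) = 2 / 3 := by norm_num
    rw [e1, e2] at key
    calc ‖Φ p - (T p)^[n] 0‖ ≤ 4 * (2 / 3) ^ n * ‖Φ p‖ := key
      _ ≤ 4 * (2 / 3) ^ n * (r' / 2) := mul_le_mul_of_nonneg_left hΦn (by positivity)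
  -- `Φ` is complex-differentiable: Weierstrass («closed subspace» form)
  have hΦd : DifferentiableOn ℂ Φ (ball 0 ε) := by
    refine differentiableOn_of_forall_exists_near isOpen_ball fun η hη => ?_
    obtain ⟨n, hn⟩ := exists_pow_lt_of_lt_one (show 0 < η / (4 * (r' / 2) + 1) by positivity) (by norm_num : (2 : ℝ) / 3 < 1)
    refine ⟨fun p => (T p)^[n] 0, (hiter n).1, fun p hp => ?_⟩
    rw [mem_ball_zero_iff] at hp
    have h := happrox n p hp
    have hb : 4 * (2 / 3 : ℝ) ^ n * (r' / 2) ≤ η := by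
      have h1 : (2 / 3 : ℝ) ^ n * (4 * (r' / 2) + 1) < η := by
        rwa [lt_div_iff₀ (by positivity)] at hn
      nlinarith [pow_nonneg (show (0 : ℝ) ≤ 2 / 3 by norm_num) n, hr']
    exact h.trans hb
  refine ⟨Φ, Literature.Analysis.Complex.HolomorphicBanach.analyticOnNhd_of_differentiableOn hΦd isOpen_ball, fun p hp => ?_⟩
  rw [mem_ball_zero_iff] at hp
  have hΦn : ‖Φ p‖ ≤ r' / 2 := by
    have h := hΦmem p hp
    rw [mem_closedBall_zero_iff] at h
    linarith
  refine ⟨hΦn, (hzero_iff p (Φ p)).2 (hΦfix p hp), fun B hB hKB => ?_⟩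
  have hΦball : Φ p ∈ ball (0 : Ec) r' := by rw [mem_ball_zero_iff]; linarith
  exact fixedPoint_unique hr' hθ0 hθ1 (hTd p hp) (hTmaps p hp) hB hΦball ((hzero_iff p B).1 hKB) (hΦfix p hp)

end Literature.MathematicalPhysics.QuantumFieldTheory.Balaban1983to89.B15Prop1ParametricZeroBranch

end
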